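import Summits.QuantumAdvantage.QuantumAdvantage.Theorems.CubicForrelationNearExactIsExactTwoModSixSecondDigits
import Summits.QuantumAdvantage.QuantumAdvantage.Theorems.CubicForrelationNearExactIsExactFlatRadical

/-!
# Crux `CubicForrelation.NearExactIsExact` (stmt-QuantumAdvantage-14043) — `n = 6r+2`, type O with every point cheap:
  the first digit has rank `≤ 2` (`r ≥ 2`, uniform in `r`, includes `n = 14`)

Certificate seat `b2b-cforr-cert` (gen 9).  HONEST FRAMING: a structural lemma about cubic Boolean functions on `6r+2` bits sharpening the
certified residual list at the second boundary (`second_boundary_structure_fourteen_sharp`, `tm2_second_structure`): in the type-O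
alternative "every point cheap" (`u ≡ 2^r ± 1 (mod 8)`, i.e. case A at `n = 14`, `d₁ = d₂` for `r ≥ 3`) the quadratic first digit
`d₁ = [⌊u/2⌋ odd]` automatically has radical `#R ≥ 2^{6r}` (rank `≤ 2`).  NOT summit progress.

Proof: cheap means `u ≡ 2^r + (−1)^{d₁} (mod 8)`; parametrised 4-flat sums of `u = W_g/2^{2r+1}` are `≡ 0 (mod 8)` (`fs_flat_sum_dvd`),
so 4-flat sign sums of `d₁` are `≡ 0 (mod 8)`; 3-flat sign sums of the quadratic `d₁` are `≡ 0 (mod 4)` (Ax); hence `fr_radical_large`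
(two orthogonal hyperbolic pairs would give a 4-flat with sign sum `±4`).

References: F. J. MacWilliams, N. J. A. Sloane (1977) Ch. 15 §2; J. Ax (1964).  Everything below is proved from Mathlib and the tree;
axioms are the standard three.
-/

set_option linter.dupNamespace false -- D-0017: single-problem summit ⇒ `QuantumAdvantage.QuantumAdvantage` by design

noncomputable section

namespace Summit.QuantumAdvantage.QuantumAdvantage.Theorems.CubicForrelation.NearExactIsExact

open Finset
open Literature.Computability.QuantumComplexity
open Literature.Computability.QuantumComplexity.BuzetChailloux (bxor zeroVec bxor_zeroVec zeroVec_bxor)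
open Literature.Computability.QuantumComplexity.DerivativeWalsh (W)

/-- **Ax on a parametrised 3-flat for a quadratic**: `4 ∣ Σ_{ε∈𝔽₂³} sZ(q(b ⊕ a_ε))`. [cite: MacWilliamsSloane1977, Ch. 15 §2] -/
theorem tm2_quad_sum3 {n : ℕ} (q : (Fin n → Bool) → Bool) (hq : IsDegLeFun 2 q) (b : Fin n → Bool) (a : Fin 3 → Fin n → Bool) :
    (4 : ℤ) ∣ ∑ ε : Fin 3 → Bool, sZ (q (fun j => b j ^^ decide (Odd #(univ.filter fun i => ε i && a i j)))) := by
  classical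
  obtain ⟨z, hz⟩ := stub_axParity 3 2 _ univ (by norm_num) (fs_deg_pullback q hq b a)
  rw [filter_true_of_mem (fun (u : Fin 3 → Bool) (_ : u ∈ univ) i (_ : u i = true) => mem_univ i), card_univ,
    Fintype.card_fin, show (3 + 2 - 1) / 2 = 2 by norm_num] at hz
  refine ⟨z, ?_⟩
  have h : ((∑ ε : Fin 3 → Bool, sZ (q (fun j => b j ^^ decide (Odd #(univ.filter fun i => ε i && a i j)))) : ℤ) : ℝ) =
      (((4 : ℤ) * z : ℤ) : ℝ) := by
    push_cast
    rw [sum_congr rfl fun ε _ => tp_sZ_cast _, hz]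
    norm_num
  exact_mod_cast h

/-- **Every point cheap ⇒ rank `d₁ ≤ 2`** (`n = 6r+2`, `r ≥ 2`).  For cubic `g` with `W_g = 2^{2r+1}u` and `u ≡ 2^r ± 1 (mod 8)` everywhere,
the radical of the first digit `[⌊u/2⌋ odd]` has at least `2^{6r}` elements.  Uniform in `r`; NOT summit progress. [this work] -/
theorem tm2_cheap_rank_le_two (r : ℕ) (hr : 2 ≤ r) (g : (Fin ((3 * r + 1) + (3 * r + 1)) → Bool) → Bool)
    (u : (Fin ((3 * r + 1) + (3 * r + 1)) → Bool) → ℤ) (hg : IsDegLeFun 3 g)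
    (hu : ∀ x, W (fun y => signOf (g y)) x = (2 : ℝ) ^ (2 * r + 1) * (u x : ℝ))
    (hcheap : ∀ x, (8 : ℤ) ∣ u x - 2 ^ r - 1 ∨ (8 : ℤ) ∣ u x - 2 ^ r + 1) :
    2 ^ (6 * r) ≤ #(univ.filter fun a : Fin ((3 * r + 1) + (3 * r + 1)) → Bool => ∀ b,
      (decide (Odd (u zeroVec / 2)) ^^ decide (Odd (u a / 2)) ^^ decide (Odd (u b / 2)) ^^ decide (Odd (u (bxor a b) / 2))) = false) := by
  classical
  have h4 : (2 : ℤ) ^ r = 4 * 2 ^ (r - 2) := by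
    rw [show (4 : ℤ) = 2 ^ 2 by norm_num, ← pow_add]; congr 1; omega
  have hodd : ∀ x, Odd (u x) := by
    intro x
    rw [Int.odd_iff]
    rcases hcheap x with h | h <;> omega
  have hd1 : IsDegLeFun 2 (fun x => decide (Odd (u x / 2))) := tm2_digitOne r g u hg hu hodd
  -- `u ≡ 2^r + (−1)^{d₁} (mod 8)`
  have hc8 : ∀ x, (8 : ℤ) ∣ u x - 2 ^ r - sZ (decide (Odd (u x / 2))) := by
    intro x
    have hux := Int.odd_iff.1 (hodd x)
    by_cases ho : Odd (u x / 2)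
    · have ho' := Int.odd_iff.1 ho
      rw [decide_eq_true ho, show sZ true = -1 from rfl]
      rcases hcheap x with h | h <;> omega
    · have ho' := Int.not_odd_iff_even.1 ho
      rw [Int.even_iff] at ho'
      rw [decide_eq_false ho, show sZ false = 1 from rfl]
      rcases hcheap x with h | h <;> omega
  set d : (Fin ((3 * r + 1) + (3 * r + 1)) → Bool) → Bool := fun x => decide (Odd (u x / 2)) with hd
  -- (H4): 4-flat sign sums of `d₁` are `≡ 0 (mod 8)`
  have H4 : ∀ (x a₀ a₁ a₂ a₃ : Fin ((3 * r + 1) + (3 * r + 1)) → Bool),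
      (8 : ℤ) ∣ ∑ ε : Fin 4 → Bool, sZ (d (fun j => x j ^^ decide (Odd #(univ.filter fun i =>
        ε i && (![a₀, a₁, a₂, a₃] : Fin 4 → Fin ((3 * r + 1) + (3 * r + 1)) → Bool) i j)))) := by
    intro x a₀ a₁ a₂ a₃
    have hflat := fs_flat_sum_dvd (e := 3) g u hg hu x (![a₀, a₁, a₂, a₃]) (by omega)
    have hsplit : ∀ y, sZ (d y) = u y - (u y - 2 ^ r - sZ (d y)) - 2 ^ r := fun y => by ring
    rw [sum_congr rfl fun ε _ => hsplit _, sum_sub_distrib, sum_sub_distrib, sum_const, card_univ, Fintype.card_fun,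
      Fintype.card_bool, Fintype.card_fin]
    refine dvd_sub (dvd_sub (by simpa using hflat) (dvd_sum fun ε _ => hc8 _)) ⟨2 * 2 ^ r, ?_⟩
    rw [nsmul_eq_mul]; push_cast; ring
  -- (H3): 3-flat sign sums of the quadratic `d₁` are `≡ 0 (mod 4)`
  have H3 : ∀ (x a b c : Fin ((3 * r + 1) + (3 * r + 1)) → Bool),
      (4 : ℤ) ∣ ∑ ε : Fin 3 → Bool, sZ (d (fun j => x j ^^ decide (Odd #(univ.filter fun i =>
        ε i && (![a, b, c] : Fin 3 → Fin ((3 * r + 1) + (3 * r + 1)) → Bool) i j)))) :=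
    fun x a b c => tm2_quad_sum3 d hd1 x ![a, b, c]
  have hbig := fr_radical_large (univ : Finset (Fin ((3 * r + 1) + (3 * r + 1)) → Bool)) (fun _ => True) zeroVec d
    (fun a _ b _ => mem_univ _) trivial (fun _ _ _ _ => trivial) (fun _ _ => mem_univ _)
    (fun x _ a b c _ _ _ => H3 x a b c) (fun x _ a₀ a₁ a₂ a₃ _ _ _ _ => H4 x a₀ a₁ a₂ a₃)
  have hRR : (univ.filter fun a : Fin ((3 * r + 1) + (3 * r + 1)) → Bool => ∀ b ∈ (univ : Finset _),
      (d zeroVec ^^ d (bxor zeroVec a) ^^ d (bxor zeroVec b) ^^ d (bxor (bxor zeroVec a) b)) = false) =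
      univ.filter (fun a : Fin ((3 * r + 1) + (3 * r + 1)) → Bool => ∀ b,
        (decide (Odd (u zeroVec / 2)) ^^ decide (Odd (u a / 2)) ^^ decide (Odd (u b / 2)) ^^ decide (Odd (u (bxor a b) / 2))) = false) := by
    refine filter_congr fun a _ => ?_
    simp only [mem_univ, true_implies, zeroVec_bxor, d]
  rw [hRR, card_univ, Fintype.card_fun, Fintype.card_bool, Fintype.card_fin] at hbig
  have hN : (2 : ℕ) ^ ((3 * r + 1) + (3 * r + 1)) = 4 * 2 ^ (6 * r) := by
    rw [show (3 * r + 1) + (3 * r + 1) = 6 * r + 2 by ring, pow_add]; ring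
  rw [hN] at hbig
  exact Nat.le_of_mul_le_mul_left hbig (by norm_num)

end Summit.QuantumAdvantage.QuantumAdvantage.Theorems.CubicForrelation.NearExactIsExact

end
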